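import Mathlib.Analysis.Calculus.DifferentialForm.Basic
import Mathlib.Analysis.Calculus.ContDiff.Convolution
import Mathlib.Analysis.Calculus.BumpFunction.FiniteDimension
import Mathlib.MeasureTheory.Integral.IntervalIntegral.FundThmCalculus
import Mathlib.MeasureTheory.Integral.Prod
import Mathlib.MeasureTheory.Constructions.Pi
import Mathlib.MeasureTheory.Measure.Haar.OfBasis
import Mathlib.MeasureTheory.Measure.Lebesgue.EqHaar
import Mathlib.LinearAlgebra.Trace
import Mathlib.LinearAlgebra.Determinant
import Mathlib.Topology.Instances.Matrix
import Mathlib.Topology.Algebra.Module.FiniteDimension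
import HarnessLib

/-!
# The compactly supported Poincaré lemma in top degree (flat case)

Topic: integration of differential forms / top de Rham cohomology (Lee (2013), Ch. 17), the
flat-space input for `Literature.Geometry.Kaehler.deRhamCohomology.integral_bijective`
(`Literature/NumberTheory/Transcendental/FormIntegration.lean`): on a finite-dimensional real
normed space `E` with a basis `e : Basis (Fin (m + 1)) ℝ E`, a smooth compactly supported
function `f` supported in an open coordinate box and with `∫ f ∂e.addHaar = 0` is of the form
`f • D = dη` for a smooth `m`-form `η` compactly supported in the same box, for every continuous
alternating top form `D` (`Literature.NumberTheory.Transcendental.exists_extDeriv_eq_smul_of_integral_eq_zero`). This is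
Lee (2013), Lemma 17.27 in the case `p = n` (there for balls; boxes are what the inductive
fibre-integration proof produces).

## Main statements (all proved)

* `Literature.basisDetL e`: the determinant form of a basis as a *continuous* alternating map.
* `Literature.NumberTheory.Transcendental.alternatizeUncurryFin_curryLeft_comp`, `Literature.NumberTheory.Transcendental.extDeriv_curryLeft_comp`: the divergence
  identity `d (ι_Y D) = tr (DY) • D` for a constant top form `D` on `E`.
* `Literature.NumberTheory.Transcendental.FlatPoincare.exists_sum_partialDeriv_eq_of_integral_eq_zero`: on `ℝᵐ = Fin m → ℝ`, a
  smooth compactly supported `f` with support in an open box and `∫ f = 0` is a divergence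
  `∑ⱼ ∂ⱼ Xⱼ` of a smooth vector field compactly supported in the box (induction on `m` by
  fibre integration, as in Bott–Tu (1982), §I.4, Prop. 4.6 / Lee (2013), Lemma 17.27).
* `Literature.NumberTheory.Transcendental.map_equivFunL_addHaar`: `e.equivFunL` pushes `e.addHaar` to Lebesgue measure.
* `Literature.NumberTheory.Transcendental.exists_extDeriv_eq_smul_of_integral_eq_zero`: the form-level statement on `E`.

## Mathlib status

Mathlib (pinned v4.32.0) has `extDeriv`, `extDeriv_extDeriv`, `extDeriv_pullback`, smooth bump
functions, differentiation under the integral sign via `contDiffOn_convolution_right_with_param`,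
the FTC and Fubini, but no Poincaré lemma (neither the ordinary nor the compactly supported
one; searched `Poincare`, `poincareLemma`, `compact support` in `Analysis/Calculus`). The proof
here avoids the ordinary Poincaré lemma and Stokes (used in Lee's proof) by the direct
fibre-integration induction.

## References

* J. M. Lee, *Introduction to Smooth Manifolds*, 2nd ed., GTM 218, Springer (2013),
  Lemma 17.27 (p. 483), Thm. 17.30 (p. 485).
* R. Bott, L. W. Tu, *Differential Forms in Algebraic Topology*, GTM 82, Springer (1982), §I.4.
-/

noncomputable section

open scoped Topology ContDiff Convolution
open Set Function MeasureTheory Filter Metric Module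

namespace Literature.NumberTheory.Transcendental


section Algebra

variable {E : Type*} [NormedAddCommGroup E] [NormedSpace ℝ E] [FiniteDimensional ℝ E]
  {ι : Type*} [Fintype ι] [DecidableEq ι]

/-- The determinant form of a basis of a finite-dimensional real normed space is continuous
(it is a polynomial in the coordinates). [folklore] -/
theorem continuous_basis_det (e : Basis ι ℝ E) : Continuous fun v : ι → E ↦ e.det v := by
  simp_rw [Basis.det_apply]
  refine Continuous.matrix_det ?_
  refine continuous_pi fun i ↦ continuous_pi fun j ↦ ?_
  simp only [Basis.toMatrix_apply]
  exact (e.coord i).continuous_of_finiteDimensional.comp (continuous_apply j)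

/-- The determinant form `e.det` of a basis `e` of a finite-dimensional real normed space, as a
*continuous* alternating map (the coordinate volume form `dx¹ ∧ ⋯ ∧ dxⁿ` of the basis;
Lee (2013), Prop. 14.9 / eq. (14.4)). [cite: LeeSmoothManifolds2013, Prop. 14.9] -/
def basisDetL (e : Basis ι ℝ E) : E [⋀^ι]→L[ℝ] ℝ :=
  { e.det with cont := continuous_basis_det e }

/-- `basisDetL e` is `e.det` as a function. [folklore] -/
@[simp]
theorem basisDetL_apply (e : Basis ι ℝ E) (v : ι → E) : basisDetL e v = e.det v := rfl

/-- The underlying alternating map of `basisDetL e` is `e.det`. [folklore] -/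
theorem toAlternatingMap_basisDetL (e : Basis ι ℝ E) :
    (basisDetL e).toAlternatingMap = e.det := rfl

/-- `basisDetL e e = 1`. [folklore] -/
theorem basisDetL_self (e : Basis ι ℝ E) : basisDetL e e = 1 := by
  simp [Basis.det_self]

omit [FiniteDimensional ℝ E] in
/-- Trace identity for an alternating top form `D`, a basis `e` and an endomorphism `L`:
`∑ i, D (e₁, …, L eᵢ, …, eₙ) = tr L · D (e₁, …, eₙ)`. [folklore] -/
theorem sum_map_update_basis_eq_trace_mul (e : Basis ι ℝ E) (D : E [⋀^ι]→ₗ[ℝ] ℝ)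
    (L : E →ₗ[ℝ] E) :
    ∑ i, D (update e i (L (e i))) = LinearMap.trace ℝ E L * D e := by
  have key : ∀ i, D (update e i (L (e i))) = e.repr (L (e i)) i * D e := by
    intro i
    have hlin : ∀ w, D (update (⇑e) i w) = D.toMultilinearMap.toLinearMap e i w := fun w ↦ by
      simp [MultilinearMap.toLinearMap_apply]
    conv_lhs => rw [← e.sum_repr (L (e i))]
    rw [hlin, map_sum]
    simp_rw [map_smul, ← hlin, smul_eq_mul]
    rw [Finset.sum_eq_single i]
    · rw [update_eq_self]
    · intro j _ hji
      rw [D.map_update_self _ hji.symm, mul_zero]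
    · intro hi; exact absurd (Finset.mem_univ i) hi
  simp_rw [key, ← Finset.sum_mul]
  congr 1
  rw [LinearMap.trace_eq_matrix_trace ℝ e L, Matrix.trace]
  simp [LinearMap.toMatrix_apply]

variable {m : ℕ}

omit [FiniteDimensional ℝ E] in
/-- The divergence identity for a continuous alternating top form `D` on `E` and `L : E →L E`:
the alternatization of `v ↦ ι_{L v} D` is `tr L • D` (the pointwise content of
`d (ι_Y D) = (div Y) D`, Cartan's formula for a constant top form). [folklore] -/
theorem alternatizeUncurryFin_curryLeft_comp (e : Basis (Fin (m + 1)) ℝ E)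
    (D : E [⋀^Fin (m + 1)]→L[ℝ] ℝ) (L : E →L[ℝ] E) :
    ContinuousAlternatingMap.alternatizeUncurryFin (D.curryLeft.comp L) =
      (LinearMap.trace ℝ E (L : E →ₗ[ℝ] E)) • D := by
  apply ContinuousAlternatingMap.toAlternatingMap_injective
  rw [ContinuousAlternatingMap.toAlternatingMap_smul,
    AlternatingMap.eq_smul_basis_det e
      (ContinuousAlternatingMap.alternatizeUncurryFin (D.curryLeft.comp L)).toAlternatingMap,
    AlternatingMap.eq_smul_basis_det e D.toAlternatingMap, smul_smul]
  congr 1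
  simp only [ContinuousAlternatingMap.coe_toAlternatingMap,
    ContinuousAlternatingMap.alternatizeUncurryFin_apply, ContinuousLinearMap.coe_comp,
    Function.comp_apply, ContinuousAlternatingMap.curryLeft_apply_apply]
  have h1 : ∀ i : Fin (m + 1), (-1 : ℝ) ^ (i : ℕ) • D (Matrix.vecCons (L (e i)) (i.removeNth e))
      = D (update e i (L (e i))) := by
    intro i
    rw [← Fin.insertNth_removeNth, ContinuousAlternatingMap.map_insertNth]
    simp [zsmul_eq_mul, smul_eq_mul]
  have h2 := sum_map_update_basis_eq_trace_mul e D.toAlternatingMap (L : E →ₗ[ℝ] E)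
  simp only [ContinuousAlternatingMap.coe_toAlternatingMap, ContinuousLinearMap.coe_coe] at h2
  rw [← h2]
  refine Finset.sum_congr rfl fun i _ ↦ ?_
  simpa [zsmul_eq_mul] using h1 i

omit [FiniteDimensional ℝ E] in
/-- `d (ι_Y D) = (div Y) • D` for a constant continuous alternating top form `D` on `E` and a
differentiable vector field `Y : E → E` (`div Y = tr DY`). [folklore] -/
theorem extDeriv_curryLeft_comp (e : Basis (Fin (m + 1)) ℝ E) (D : E [⋀^Fin (m + 1)]→L[ℝ] ℝ)
    {Y : E → E} {y : E} (hY : DifferentiableAt ℝ Y y) :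
    extDeriv (fun z ↦ D.curryLeft (Y z)) y =
      (LinearMap.trace ℝ E (fderiv ℝ Y y : E →ₗ[ℝ] E)) • D := by
  rw [extDeriv]
  have : fderiv ℝ (fun z ↦ D.curryLeft (Y z)) y = D.curryLeft.comp (fderiv ℝ Y y) :=
    (D.curryLeft.hasFDerivAt.comp y hY.hasFDerivAt).fderiv
  rw [this, alternatizeUncurryFin_curryLeft_comp e]

end Algebra

namespace FlatPoincare

variable {P : Type*} [NormedAddCommGroup P] [NormedSpace ℝ P]

/-- Smoothness of a fibre integral with parameters: if `g : P → ℝ → ℝ` is jointly smooth and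
vanishes for `u` outside a fixed compact set, then `p ↦ ∫ u, g p u` is smooth (differentiation
under the integral sign, via Mathlib's convolution-with-parameter theorem). [folklore] -/
theorem contDiff_integral_param {g : P → ℝ → ℝ} {k : Set ℝ} (hk : IsCompact k)
    (hgs : ∀ p u, u ∉ k → g p u = 0) (hg : ContDiff ℝ ∞ ↿g) :
    ContDiff ℝ ∞ fun p ↦ ∫ u, g p u := by
  have h1 := contDiffOn_convolution_right_with_param (𝕜 := ℝ) (μ := volume)
    (f := fun _ : ℝ ↦ (1 : ℝ)) (ContinuousLinearMap.mul ℝ ℝ) (s := univ) isOpen_univ hk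
    (fun p u _ hu ↦ hgs p u hu) (locallyIntegrable_const 1) (hg.contDiffOn)
  have h2 : ContDiff ℝ ∞ fun q : P × ℝ ↦ ((fun _ : ℝ ↦ (1 : ℝ)) ⋆[ContinuousLinearMap.mul ℝ ℝ, volume] g q.1) q.2 := by
    rw [← contDiffOn_univ, ← univ_prod_univ]; exact h1
  have h3 : (fun p ↦ ∫ u, g p u) = (fun q : P × ℝ ↦
      ((fun _ : ℝ ↦ (1 : ℝ)) ⋆[ContinuousLinearMap.mul ℝ ℝ, volume] g q.1) q.2) ∘ fun p ↦ (p, 0) := by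
    funext p
    simp only [comp_apply, convolution_mul_swap, one_mul]
  rw [h3]
  exact h2.comp (contDiff_id.prodMk contDiff_const)

/-- Smoothness of a primitive along the fibre with parameters: if `g : P → ℝ → ℝ` is jointly
smooth and vanishes for `u` outside a fixed compact set, then `(p, t) ↦ ∫ u in Iic t, g p u` is
smooth (it is the convolution of the Heaviside function with `g p`). [folklore] -/
theorem contDiff_setIntegral_Iic_param {g : P → ℝ → ℝ} {k : Set ℝ} (hk : IsCompact k)
    (hgs : ∀ p u, u ∉ k → g p u = 0) (hg : ContDiff ℝ ∞ ↿g) :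
    ContDiff ℝ ∞ fun q : P × ℝ ↦ ∫ u in Iic q.2, g q.1 u := by
  have hloc : LocallyIntegrable (indicator (Ici (0 : ℝ)) fun _ ↦ (1 : ℝ)) volume :=
    (locallyIntegrable_const 1).indicator measurableSet_Ici
  have h1 := contDiffOn_convolution_right_with_param (𝕜 := ℝ) (μ := volume)
    (f := indicator (Ici (0 : ℝ)) fun _ ↦ (1 : ℝ)) (ContinuousLinearMap.mul ℝ ℝ) (s := univ)
    isOpen_univ hk (fun p u _ hu ↦ hgs p u hu) hloc (hg.contDiffOn)
  have h2 : ContDiff ℝ ∞ fun q : P × ℝ ↦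
      ((indicator (Ici (0 : ℝ)) fun _ ↦ (1 : ℝ)) ⋆[ContinuousLinearMap.mul ℝ ℝ, volume] g q.1) q.2 := by
    rw [← contDiffOn_univ, ← univ_prod_univ]; exact h1
  convert h2 using 2 with q
  rw [convolution_mul_swap, ← integral_indicator measurableSet_Iic]
  congr 1 with u
  simp only [indicator, mem_Ici, mem_Iic, sub_nonneg]
  split_ifs <;> simp

/-- A smooth bump on an interval with integral one. [folklore] -/
theorem exists_smooth_bump_integral_eq_one {c d : ℝ} (hcd : c < d) :
    ∃ θ : ℝ → ℝ, ContDiff ℝ ∞ θ ∧ HasCompactSupport θ ∧ tsupport θ ⊆ Ioo c d ∧ ∫ t, θ t = 1 := by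
  obtain ⟨θ₀, hsupp, hcpt, hsmooth, hrange, hmid⟩ := exists_contDiff_tsupport_subset (n := ⊤)
    (x := (c + d) / 2) (s := Ioo c d) (Ioo_mem_nhds (by linarith) (by linarith))
  have hcont : Continuous θ₀ := hsmooth.continuous
  have hnn : ∀ t, 0 ≤ θ₀ t := fun t ↦ (hrange (mem_range_self t)).1
  have hint : Integrable θ₀ := hcont.integrable_of_hasCompactSupport hcpt
  have hpos : 0 < ∫ t, θ₀ t := by
    rw [integral_pos_iff_support_of_nonneg hnn hint]
    exact hcont.isOpen_support.measure_pos volume ⟨(c + d) / 2, by simp [hmid]⟩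
  refine ⟨fun t ↦ θ₀ t * (∫ t, θ₀ t)⁻¹, hsmooth.mul contDiff_const, hcpt.mul_right, ?_, ?_⟩
  · exact (tsupport_mul_subset_left (f := θ₀) (g := fun _ ↦ (∫ t, θ₀ t)⁻¹)).trans hsupp
  · rw [integral_mul_const, mul_inv_cancel₀ hpos.ne']

/-- A compact subset of an open interval lies in a compact subinterval. [folklore] -/
theorem exists_Icc_of_isCompact_subset_Ioo {c d : ℝ} (hcd : c < d) {L : Set ℝ} (hL : IsCompact L)
    (hLsub : L ⊆ Ioo c d) : ∃ c' d', c < c' ∧ c' ≤ d' ∧ d' < d ∧ L ⊆ Icc c' d' := by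
  rcases L.eq_empty_or_nonempty with rfl | hne
  · exact ⟨(c + d) / 2, (c + d) / 2, by linarith, le_rfl, by linarith, empty_subset _⟩
  obtain ⟨x, hx⟩ := hL.exists_isLeast hne
  obtain ⟨y, hy⟩ := hL.exists_isGreatest hne
  exact ⟨x, y, (hLsub hx.1).1, hx.2 hy.1, (hLsub hy.1).2, fun z hz ↦ ⟨hx.2 hz, hy.2 hz⟩⟩

/-- Primitive of an integrable function vanishing below `c`, as an interval integral. [folklore] -/
theorem setIntegral_Iic_eq_intervalIntegral {φ : ℝ → ℝ} (hφ : Integrable φ) {c : ℝ}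
    (hc : ∀ u, u ≤ c → φ u = 0) (t : ℝ) : ∫ u in Iic t, φ u = ∫ u in c..t, φ u := by
  rw [← intervalIntegral.integral_Iic_sub_Iic hφ.integrableOn hφ.integrableOn,
    setIntegral_eq_zero_of_forall_eq_zero (t := Iic c) fun u hu ↦ hc u hu, sub_zero]

/-- Fundamental theorem of calculus for `t ↦ ∫ u in Iic t, φ u`, `φ` continuous with compact
support. [folklore] -/
theorem hasDerivAt_setIntegral_Iic {φ : ℝ → ℝ} (hφc : Continuous φ) (hφs : HasCompactSupport φ)
    (t : ℝ) : HasDerivAt (fun t ↦ ∫ u in Iic t, φ u) (φ t) t := by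
  have hint : Integrable φ := hφc.integrable_of_hasCompactSupport hφs
  obtain ⟨c, hc⟩ : ∃ c, ∀ u, u ≤ c → φ u = 0 := by
    obtain ⟨R, hR⟩ := (hφs.isCompact.isBounded.subset (subset_tsupport φ)).subset_closedBall 0
    refine ⟨-(R + 1), fun u hu ↦ ?_⟩
    by_contra h
    have := hR (mem_support.2 h)
    rw [mem_closedBall, dist_zero_right, Real.norm_eq_abs, abs_le] at this
    linarith [this.1]
  have heq : (fun t ↦ ∫ u in Iic t, φ u) = fun t ↦ ∫ u in c..t, φ u :=
    funext (setIntegral_Iic_eq_intervalIntegral hint hc)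
  rw [heq]
  exact intervalIntegral.integral_hasDerivAt_right (hint.intervalIntegrable)
    (hφc.stronglyMeasurableAtFilter _ _) hφc.continuousAt

/-- If `φ` is integrable and vanishes above `d`, then `∫ u in Iic t, φ u = ∫ u, φ u` for `t ≥ d`.
[folklore] -/
theorem setIntegral_Iic_eq_integral {φ : ℝ → ℝ} (hφ : Integrable φ) {d t : ℝ}
    (hd : ∀ u, d < u → φ u = 0) (ht : d ≤ t) : ∫ u in Iic t, φ u = ∫ u, φ u := by
  rw [← intervalIntegral.integral_Iic_add_Ioi (b := t) hφ.integrableOn hφ.integrableOn,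
    setIntegral_eq_zero_of_forall_eq_zero (t := Ioi t) fun u hu ↦ hd u (lt_of_le_of_lt ht hu),
    add_zero]

variable {m : ℕ}

/-- `Fin.tail` of a coordinate vector in a successor direction. [folklore] -/
theorem tail_single_succ (j : Fin m) (x : ℝ) :
    Fin.tail (Pi.single (M := fun _ : Fin (m + 1) ↦ ℝ) j.succ x) = Pi.single j x := by
  ext i
  simp only [Fin.tail, Pi.single_apply, Fin.succ_inj]

/-- `Fin.tail` of the zeroth coordinate vector vanishes. [folklore] -/
theorem tail_single_zero (x : ℝ) :
    Fin.tail (Pi.single (M := fun _ : Fin (m + 1) ↦ ℝ) 0 x) = 0 := by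
  ext i
  simp [Fin.tail, Fin.succ_ne_zero]

/-- If `t ↦ Φ (z, t)` has derivative `φ` at `t` and `Φ` is differentiable, then the derivative
of `Φ` in the direction `(0, 1)` is `φ`. [folklore] -/
theorem fderiv_apply_zero_one {Φ : P × ℝ → ℝ} {z : P} {t φ : ℝ}
    (hΦ : DifferentiableAt ℝ Φ (z, t)) (hd : HasDerivAt (fun s ↦ Φ (z, s)) φ t) :
    fderiv ℝ Φ (z, t) (0, 1) = φ := by
  have h1 : HasFDerivAt (fun s : ℝ ↦ Φ (z, s))
      ((fderiv ℝ Φ (z, t)).comp (ContinuousLinearMap.inr ℝ P ℝ)) t :=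
    hΦ.hasFDerivAt.comp t (hasFDerivAt_prodMk_right z t)
  have h2 := hd.hasFDerivAt.unique h1
  have := congrArg (fun L : ℝ →L[ℝ] ℝ ↦ L 1) h2
  simpa using this.symm

/-- **Poincaré lemma with compact support in top degree, divergence form** (Lee (2013),
Lemma 17.27 for `p = n`; proof by induction on the dimension via fibre integration as in
Bott–Tu (1982), §I.4): a smooth function on `ℝᵐ` with compact support in an open coordinate box
and with zero integral is the divergence `∑ⱼ ∂ⱼ Xⱼ` of a smooth vector field with compact support
in the same box. [cite: LeeSmoothManifolds2013, Lemma 17.27] -/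
theorem exists_sum_partialDeriv_eq_of_integral_eq_zero :
    ∀ (m : ℕ) (a b : Fin m → ℝ) (f : (Fin m → ℝ) → ℝ), ContDiff ℝ ∞ f → HasCompactSupport f →
      tsupport f ⊆ Set.pi univ (fun j ↦ Ioo (a j) (b j)) → ∫ y, f y = 0 →
      ∃ X : Fin m → (Fin m → ℝ) → ℝ, (∀ j, ContDiff ℝ ∞ (X j)) ∧ (∀ j, HasCompactSupport (X j)) ∧
        (∀ j, tsupport (X j) ⊆ Set.pi univ (fun j ↦ Ioo (a j) (b j))) ∧
        ∀ y, ∑ j, fderiv ℝ (X j) y (Pi.single j 1) = f y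
  | 0, a, b, f, hf, hcs, hsupp, hint => by
    refine ⟨fun _ ↦ 0, fun _ ↦ contDiff_const, fun _ ↦ ?_, fun _ ↦ by simp, fun y ↦ ?_⟩
    · exact HasCompactSupport.intro isCompact_empty fun _ _ ↦ rfl
    · have h1 : ∫ y, f y = f y := by
        rw [Measure.volume_pi_eq_dirac y, integral_dirac]
      simp [← h1, hint]
  | m + 1, a, b, f, hf, hcs, hsupp, hint => by
    -- the splitting `ℝ × ℝᵐ ≃ ℝᵐ⁺¹`
    set C := Fin.consEquivL ℝ (fun _ : Fin (m + 1) ↦ ℝ) with hC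
    have hCapp : ∀ q : ℝ × (Fin m → ℝ), C q = Fin.cons q.1 q.2 := fun q ↦ rfl
    have hCsymm : ∀ y : Fin (m + 1) → ℝ, C.symm y = (y 0, Fin.tail y) := fun y ↦ rfl
    have htail : ContDiff ℝ ∞ (Fin.tail : (Fin (m + 1) → ℝ) → Fin m → ℝ) := by
      have : (Fin.tail : (Fin (m + 1) → ℝ) → Fin m → ℝ) = Prod.snd ∘ C.symm := by
        funext y; rw [comp_apply, hCsymm]
      rw [this]; exact contDiff_snd.comp C.symm.contDiff
    have hev0 : ContDiff ℝ ∞ (fun y : Fin (m + 1) → ℝ ↦ y 0) := contDiff_apply ℝ ℝ 0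
    set a' : Fin m → ℝ := Fin.tail a with ha'
    set b' : Fin m → ℝ := Fin.tail b with hb'
    -- degenerate box
    rcases le_or_gt (b 0) (a 0) with hab | hab
    · have hf0 : ∀ y, f y = 0 := by
        intro y
        by_contra h
        have hy := hsupp (subset_tsupport f (mem_support.2 h))
        have := (mem_univ_pi.1 hy) 0
        exact absurd (this.1.trans this.2) (not_lt_of_ge hab)
      refine ⟨fun _ ↦ 0, fun _ ↦ contDiff_const, fun _ ↦ ?_, fun _ ↦ by simp, fun y ↦ ?_⟩
      · exact HasCompactSupport.intro isCompact_empty fun _ _ ↦ rfl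
      · simp [hf0]
    -- bump in the first coordinate
    obtain ⟨θ, hθs, hθc, hθsupp, hθint⟩ := exists_smooth_bump_integral_eq_one hab
    -- compact data
    set K := tsupport f with hK
    have hKc : IsCompact K := hcs
    set K' : Set (Fin m → ℝ) := Fin.tail '' K with hK'
    have hK'c : IsCompact K' := hKc.image htail.continuous
    have hK'box : K' ⊆ Set.pi univ (fun j ↦ Ioo (a' j) (b' j)) := by
      rintro _ ⟨y, hy, rfl⟩
      exact mem_univ_pi.2 fun j ↦ (mem_univ_pi.1 (hsupp hy)) j.succ
    obtain ⟨c, d, hac, hcd, hdb, hLcd⟩ := exists_Icc_of_isCompact_subset_Ioo hab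
      ((hKc.image (continuous_apply 0)).union hθc.isCompact)
      (union_subset (by rintro _ ⟨y, hy, rfl⟩; exact (mem_univ_pi.1 (hsupp hy)) 0) hθsupp)
    have hKcd : ∀ y ∈ K, y 0 ∈ Icc c d := fun y hy ↦ hLcd (Or.inl ⟨y, hy, rfl⟩)
    have hθcd : ∀ t, t ∉ Icc c d → θ t = 0 := fun t ht ↦
      image_eq_zero_of_notMem_tsupport fun h ↦ ht (hLcd (Or.inr h))
    -- the function in split coordinates
    set F : ℝ × (Fin m → ℝ) → ℝ := fun q ↦ f (C q) with hFdef
    have hFs : ContDiff ℝ ∞ F := hf.comp C.contDiff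
    have hFc : HasCompactSupport F := hcs.comp_homeomorph C.toHomeomorph
    have hF_K : ∀ t z, F (t, z) ≠ 0 → Fin.cons t z ∈ K := fun t z h ↦
      subset_tsupport f (mem_support.2 h)
    have hF_zero_t : ∀ t z, t ∉ Icc c d → F (t, z) = 0 := by
      intro t z ht; by_contra h
      exact ht (by simpa using hKcd _ (hF_K t z h))
    have hF_zero_z : ∀ t z, z ∉ K' → F (t, z) = 0 := by
      intro t z hz; by_contra h
      exact hz ⟨Fin.cons t z, hF_K t z h, by simp⟩
    have hFi : ∀ z, Integrable fun t ↦ F (t, z) := fun z ↦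
      (hFs.continuous.comp (continuous_id.prodMk continuous_const)).integrable_of_hasCompactSupport
        (HasCompactSupport.intro isCompact_Icc fun t ht ↦ hF_zero_t t z ht)
    -- the fibre integral `g`
    set g : (Fin m → ℝ) → ℝ := fun z ↦ ∫ t, F (t, z) with hgdef
    have hgs : ContDiff ℝ ∞ g :=
      contDiff_integral_param (g := fun z t ↦ F (t, z)) isCompact_Icc
        (fun z t ht ↦ hF_zero_t t z ht) (hFs.comp (contDiff_snd.prodMk contDiff_fst))
    have hg_zero : ∀ z, z ∉ K' → g z = 0 := by
      intro z hz
      simp [hgdef, hF_zero_z _ z hz]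
    have hg_supp : tsupport g ⊆ K' :=
      closure_minimal (fun z hz ↦ by_contra fun h ↦ hz (hg_zero z h)) hK'c.isClosed
    have hg_cs : HasCompactSupport g := HasCompactSupport.intro hK'c hg_zero
    have hg_int : ∫ z, g z = 0 := by
      have hFint : Integrable F (volume.prod volume) :=
        hFs.continuous.integrable_of_hasCompactSupport hFc
      have h1 : ∫ z, g z = ∫ q, F q ∂(volume.prod volume) := (integral_prod_symm F hFint).symm
      have h2 : ∫ q, F q ∂(volume.prod volume) = ∫ y, f y := by
        have := ((volume_preserving_piFinSuccAbove (fun _ : Fin (m + 1) ↦ ℝ) 0).symm _).integral_comp' f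
        have key : ∀ q : ℝ × (Fin m → ℝ),
            F q = f ((MeasurableEquiv.piFinSuccAbove (fun _ : Fin (m + 1) ↦ ℝ) 0).symm q) := by
          intro q
          rw [MeasurableEquiv.piFinSuccAbove_symm_apply, Fin.insertNthEquiv_zero]
          rfl
        simp_rw [key]
        exact this
      rw [h1, h2, hint]
    -- induction hypothesis
    obtain ⟨X', hX's, hX'c, hX'supp, hX'div⟩ := exists_sum_partialDeriv_eq_of_integral_eq_zero m
      a' b' g hgs hg_cs (hg_supp.trans hK'box) hg_int
    -- the corrected function `hh` (zero fibre integrals) and its primitive `Pr`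
    set hh : ℝ × (Fin m → ℝ) → ℝ := fun q ↦ F q - θ q.1 * g q.2 with hhdef
    have hhs : ContDiff ℝ ∞ hh := hFs.sub ((hθs.comp contDiff_fst).mul (hgs.comp contDiff_snd))
    have hh_zero_t : ∀ t z, t ∉ Icc c d → hh (t, z) = 0 := by
      intro t z ht; simp [hhdef, hF_zero_t t z ht, hθcd t ht]
    have hh_zero_z : ∀ t z, z ∉ K' → hh (t, z) = 0 := by
      intro t z hz; simp [hhdef, hF_zero_z t z hz, hg_zero z hz]
    have hhc : ∀ z, Continuous fun t ↦ hh (t, z) := fun z ↦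
      hhs.continuous.comp (continuous_id.prodMk continuous_const)
    have hhcs : ∀ z, HasCompactSupport fun t ↦ hh (t, z) := fun z ↦
      HasCompactSupport.intro isCompact_Icc fun t ht ↦ hh_zero_t t z ht
    have hhi : ∀ z, Integrable fun t ↦ hh (t, z) := fun z ↦
      (hhc z).integrable_of_hasCompactSupport (hhcs z)
    have hh_int : ∀ z, ∫ t, hh (t, z) = 0 := by
      intro z
      have hθgi : Integrable fun t ↦ θ t * g z :=
        (hθs.continuous.mul continuous_const).integrable_of_hasCompactSupport hθc.mul_right
      simp only [hhdef]
      rw [integral_sub (hFi z) hθgi, integral_mul_const, hθint, one_mul]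
      exact sub_self _
    set Pr : (Fin m → ℝ) × ℝ → ℝ := fun q ↦ ∫ u in Iic q.2, hh (u, q.1) with hPrdef
    have hPrs : ContDiff ℝ ∞ Pr :=
      contDiff_setIntegral_Iic_param (g := fun z u ↦ hh (u, z)) isCompact_Icc
        (fun z u hu ↦ hh_zero_t u z hu) (hhs.comp (contDiff_snd.prodMk contDiff_fst))
    have hPr_deriv : ∀ z t, HasDerivAt (fun s ↦ Pr (z, s)) (hh (t, z)) t := fun z t ↦
      hasDerivAt_setIntegral_Iic (hhc z) (hhcs z) t
    have hPr_zero_lt : ∀ z t, t < c → Pr (z, t) = 0 := by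
      intro z t ht
      simp only [hPrdef]
      exact setIntegral_eq_zero_of_forall_eq_zero fun u hu ↦
        hh_zero_t u z fun h ↦ (not_lt.2 h.1) (lt_of_le_of_lt (mem_Iic.1 hu) ht)
    have hPr_zero_ge : ∀ z t, d ≤ t → Pr (z, t) = 0 := by
      intro z t ht
      simp only [hPrdef]
      rw [setIntegral_Iic_eq_integral (hhi z) (fun u hu ↦ hh_zero_t u z fun h ↦
        absurd h.2 (not_le.2 hu)) ht, hh_int z]
    have hPr_zero_z : ∀ z t, z ∉ K' → Pr (z, t) = 0 := by
      intro z t hz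
      simp only [hPrdef]
      exact setIntegral_eq_zero_of_forall_eq_zero fun u _ ↦ hh_zero_z u z hz
    -- the vector field
    set X₀ : (Fin (m + 1) → ℝ) → ℝ := fun y ↦ Pr (Fin.tail y, y 0) with hX₀
    set Xs : Fin m → (Fin (m + 1) → ℝ) → ℝ := fun j y ↦ θ (y 0) * X' j (Fin.tail y) with hXs
    have hX₀s : ContDiff ℝ ∞ X₀ := hPrs.comp (htail.prodMk hev0)
    have hXss : ∀ j, ContDiff ℝ ∞ (Xs j) := fun j ↦ (hθs.comp hev0).mul ((hX's j).comp htail)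
    -- supports
    set S₀ : Set (Fin (m + 1) → ℝ) := {y | y 0 ∈ Icc c d ∧ Fin.tail y ∈ K'} with hS₀
    have hS₀_eq : S₀ = C '' (Icc c d ×ˢ K') := by
      rw [C.image_eq_preimage_symm]
      ext y
      simp [hS₀, hCsymm, mem_prod]
    have hS₀c : IsCompact S₀ := by
      rw [hS₀_eq]; exact (isCompact_Icc.prod hK'c).image C.continuous
    have hX₀S : ∀ y, y ∉ S₀ → X₀ y = 0 := by
      intro y hy
      simp only [hS₀, mem_setOf_eq, not_and_or, mem_Icc, not_and_or, not_le] at hy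
      simp only [hX₀]
      rcases hy with (h | h) | h
      · exact hPr_zero_lt _ _ h
      · exact hPr_zero_ge _ _ h.le
      · exact hPr_zero_z _ _ h
    have hX₀supp : tsupport X₀ ⊆ S₀ :=
      closure_minimal (fun y hy ↦ by_contra fun h ↦ hy (hX₀S y h)) hS₀c.isClosed
    set Ss : Fin m → Set (Fin (m + 1) → ℝ) := fun j ↦
      {y | y 0 ∈ tsupport θ ∧ Fin.tail y ∈ tsupport (X' j)} with hSs
    have hSs_eq : ∀ j, Ss j = C '' (tsupport θ ×ˢ tsupport (X' j)) := by
      intro j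
      rw [C.image_eq_preimage_symm]
      ext y
      simp [hSs, hCsymm, mem_prod]
    have hSsc : ∀ j, IsCompact (Ss j) := by
      intro j; rw [hSs_eq]; exact (hθc.isCompact.prod (hX'c j).isCompact).image C.continuous
    have hXsS : ∀ j y, y ∉ Ss j → Xs j y = 0 := by
      intro j y hy
      simp only [hSs, mem_setOf_eq, not_and_or] at hy
      simp only [hXs]
      rcases hy with h | h
      · rw [image_eq_zero_of_notMem_tsupport h, zero_mul]
      · rw [image_eq_zero_of_notMem_tsupport h, mul_zero]
    have hXssupp : ∀ j, tsupport (Xs j) ⊆ Ss j := fun j ↦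
      closure_minimal (fun y hy ↦ by_contra fun h ↦ hy (hXsS j y h)) (hSsc j).isClosed
    have hbox0 : Icc c d ⊆ Ioo (a 0) (b 0) := fun t ht ↦ ⟨hac.trans_le ht.1, ht.2.trans_lt hdb⟩
    have hθbox : tsupport θ ⊆ Ioo (a 0) (b 0) := hθsupp
    -- assemble
    obtain ⟨X, hX⟩ : ∃ X : Fin (m + 1) → (Fin (m + 1) → ℝ) → ℝ, X = Fin.cons X₀ Xs := ⟨_, rfl⟩
    have hX0 : X 0 = X₀ := by rw [hX]; rfl
    have hXj : ∀ j : Fin m, X j.succ = Xs j := fun j ↦ by rw [hX]; rfl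
    have hXall_s : ∀ j, ContDiff ℝ ∞ (X j) :=
      Fin.forall_fin_succ.2 ⟨by rw [hX0]; exact hX₀s, fun j ↦ by rw [hXj]; exact hXss j⟩
    have hXall_c : ∀ j, HasCompactSupport (X j) :=
      Fin.forall_fin_succ.2 ⟨by rw [hX0]; exact HasCompactSupport.intro hS₀c hX₀S,
        fun j ↦ by rw [hXj]; exact HasCompactSupport.intro (hSsc j) (hXsS j)⟩
    have hXall_supp : ∀ j, tsupport (X j) ⊆ Set.pi univ (fun j ↦ Ioo (a j) (b j)) := by
      refine Fin.forall_fin_succ.2 ⟨?_, fun j ↦ ?_⟩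
      · rw [hX0]
        refine hX₀supp.trans fun y hy ↦ mem_univ_pi.2 (Fin.forall_fin_succ.2 ⟨hbox0 hy.1, ?_⟩)
        exact fun j ↦ (mem_univ_pi.1 (hK'box hy.2)) j
      · rw [hXj]
        refine (hXssupp j).trans fun y hy ↦ mem_univ_pi.2 (Fin.forall_fin_succ.2 ⟨hθbox hy.1, ?_⟩)
        exact fun i ↦ (mem_univ_pi.1 (hX'supp j hy.2)) i
    have hdiv : ∀ y, ∑ j, fderiv ℝ (X j) y (Pi.single j 1) = f y := by
      intro y
      rw [Fin.sum_univ_succ, hX0]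
      simp only [hXj]
      -- zeroth term
      have h0 : fderiv ℝ X₀ y (Pi.single 0 1) = hh (y 0, Fin.tail y) := by
        have hψ : HasFDerivAt (fun y : Fin (m + 1) → ℝ ↦ (Fin.tail y, y 0))
            (((ContinuousLinearMap.snd ℝ ℝ (Fin m → ℝ)).prod (ContinuousLinearMap.fst ℝ ℝ (Fin m → ℝ))).comp
              (C.symm : (Fin (m + 1) → ℝ) →L[ℝ] ℝ × (Fin m → ℝ))) y := by
          have : (fun y : Fin (m + 1) → ℝ ↦ (Fin.tail y, y 0)) =
              ((ContinuousLinearMap.snd ℝ ℝ (Fin m → ℝ)).prod (ContinuousLinearMap.fst ℝ ℝ (Fin m → ℝ))).comp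
                (C.symm : (Fin (m + 1) → ℝ) →L[ℝ] ℝ × (Fin m → ℝ)) := by
            funext y; simp [hCsymm]
          rw [this]; exact ContinuousLinearMap.hasFDerivAt _
        have hd : DifferentiableAt ℝ Pr (Fin.tail y, y 0) := hPrs.differentiable (by simp) _
        rw [show X₀ = Pr ∘ fun y : Fin (m + 1) → ℝ ↦ (Fin.tail y, y 0) from rfl,
          (hd.hasFDerivAt.comp y hψ).fderiv]
        simp only [ContinuousLinearMap.coe_comp, comp_apply, ContinuousLinearMap.prod_apply,
          ContinuousLinearMap.coe_snd', ContinuousLinearMap.coe_fst', ContinuousLinearEquiv.coe_coe,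
          hCsymm, tail_single_zero, Pi.single_eq_same]
        exact fderiv_apply_zero_one hd (hPr_deriv _ _)
      -- successor terms
      have hs : ∀ j : Fin m, fderiv ℝ (Xs j) y (Pi.single j.succ 1) =
          θ (y 0) * fderiv ℝ (X' j) (Fin.tail y) (Pi.single j 1) := by
        intro j
        have hu : HasFDerivAt (fun y : Fin (m + 1) → ℝ ↦ θ (y 0))
            ((fderiv ℝ θ (y 0)).comp (ContinuousLinearMap.proj 0)) y :=
          ((hθs.differentiable (by simp)) _).hasFDerivAt.comp y (hasFDerivAt_apply 0 y)
        have htailL : HasFDerivAt (Fin.tail : (Fin (m + 1) → ℝ) → Fin m → ℝ)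
            ((ContinuousLinearMap.snd ℝ ℝ (Fin m → ℝ)).comp
              (C.symm : (Fin (m + 1) → ℝ) →L[ℝ] ℝ × (Fin m → ℝ))) y := by
          have : (Fin.tail : (Fin (m + 1) → ℝ) → Fin m → ℝ) =
              (ContinuousLinearMap.snd ℝ ℝ (Fin m → ℝ)).comp
                (C.symm : (Fin (m + 1) → ℝ) →L[ℝ] ℝ × (Fin m → ℝ)) := by
            funext y; simp [hCsymm]
          rw [this]; exact ContinuousLinearMap.hasFDerivAt _
        have hv : HasFDerivAt (fun y : Fin (m + 1) → ℝ ↦ X' j (Fin.tail y))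
            ((fderiv ℝ (X' j) (Fin.tail y)).comp ((ContinuousLinearMap.snd ℝ ℝ (Fin m → ℝ)).comp
              (C.symm : (Fin (m + 1) → ℝ) →L[ℝ] ℝ × (Fin m → ℝ)))) y :=
          (((hX's j).differentiable (by simp)) _).hasFDerivAt.comp y htailL
        rw [show Xs j = fun y ↦ θ (y 0) * X' j (Fin.tail y) from rfl, (hu.fun_mul hv).fderiv]
        simp only [add_apply, smul_apply,
          ContinuousLinearMap.coe_comp, comp_apply, ContinuousLinearMap.coe_snd',
          ContinuousLinearEquiv.coe_coe, hCsymm, tail_single_succ, ContinuousLinearMap.proj_apply,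
          Pi.single_apply, (Fin.succ_ne_zero j).symm, if_false, map_zero, smul_eq_mul, mul_zero,
          add_zero]
      rw [h0]
      simp_rw [hs]
      rw [← Finset.mul_sum, hX'div]
      simp only [hhdef, hFdef, hCapp, Fin.cons_self_tail]
      ring
    exact ⟨X, hXall_s, hXall_c, hXall_supp, hdiv⟩

end FlatPoincare

section Transport

variable {E : Type*} [NormedAddCommGroup E] [NormedSpace ℝ E] {ι : Type*} [Fintype ι]

section

variable [DecidableEq ι]

/-- The coordinate map of a basis sends the basis vectors to the standard basis vectors.
[folklore] -/
theorem equivFunL_basis_apply (e : Basis ι ℝ E) (i : ι) :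
    e.equivFunL (e i) = Pi.single i 1 := by
  ext j
  rw [Basis.equivFunL_apply, Basis.repr_self, Finsupp.single_eq_pi_single]

end

/-- The coordinates of `e.equivFunL.symm u` are `u`. [folklore] -/
theorem repr_equivFunL_symm (e : Basis ι ℝ E) (u : ι → ℝ) (i : ι) :
    e.repr (e.equivFunL.symm u) i = u i := by
  have : e.equivFun (e.equivFun.symm u) i = u i := by rw [LinearEquiv.apply_symm_apply]
  rwa [Basis.equivFun_apply] at this

variable [MeasurableSpace E] [BorelSpace E]

/-- The Haar measure of a basis is pushed forward to Lebesgue measure on `ι → ℝ` by the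
coordinate map of the basis. [folklore] -/
theorem map_equivFunL_addHaar (e : Basis ι ℝ E) :
    Measure.map e.equivFunL e.addHaar = volume := by
  classical
  rw [Basis.map_addHaar]
  have : e.map e.equivFunL.toLinearEquiv = Pi.basisFun ℝ ι := by
    refine Basis.eq_of_apply_eq fun i ↦ ?_
    rw [Basis.map_apply, Pi.basisFun_apply]
    exact equivFunL_basis_apply e i
  rw [this, Basis.addHaar_def, Basis.parallelepiped_basisFun, addHaarMeasure_eq_volume_pi]

/-- The coordinate map of a basis is measure preserving from the Haar measure of the basis to
Lebesgue measure. [folklore] -/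
theorem measurePreserving_equivFunL (e : Basis ι ℝ E) :
    MeasurePreserving e.equivFunL e.addHaar volume :=
  ⟨e.equivFunL.continuous.measurable, map_equivFunL_addHaar e⟩

/-- Change of variables to coordinates: `∫ f ∘ e.equivFunL⁻¹ d(Lebesgue) = ∫ f d(e.addHaar)`.
[folklore] -/
theorem integral_comp_equivFunL_symm {F' : Type*} [NormedAddCommGroup F'] [NormedSpace ℝ F']
    (e : Basis ι ℝ E) (f : E → F') :
    ∫ w, f (e.equivFunL.symm w) = ∫ y, f y ∂e.addHaar := by
  have h := (measurePreserving_equivFunL e).integral_comp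
    e.equivFunL.toHomeomorph.measurableEmbedding (fun w ↦ f (e.equivFunL.symm w))
  simp only [ContinuousLinearEquiv.symm_apply_apply] at h
  exact h.symm


variable {m : ℕ}

/-- **Poincaré lemma with compact support in top degree** on a finite-dimensional real normed
space `E` with a basis `e` indexed by `Fin (m + 1)` (Lee (2013), Lemma 17.27, case `p = n`):
if `f : E → ℝ` is smooth with compact support inside the open coordinate box
`e.equivFunL ⁻¹' ∏ⱼ (aⱼ, bⱼ)` and `∫ f ∂e.addHaar = 0`, then for every continuous alternating
top form `D` on `E` there is a smooth `m`-form `η`, compactly supported in the same box, with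
`dη = f • D`. (Proof: transport to `ℝ^{m+1}`, write `f = ∑ⱼ ∂ⱼXⱼ` by
`FlatPoincare.exists_sum_partialDeriv_eq_of_integral_eq_zero`, and take `η = ι_Y D` for the
transported vector field `Y`, using `d (ι_Y D) = (div Y) • D`.)
[cite: LeeSmoothManifolds2013, Lemma 17.27] -/
theorem exists_extDeriv_eq_smul_of_integral_eq_zero (e : Basis (Fin (m + 1)) ℝ E)
    (D : E [⋀^Fin (m + 1)]→L[ℝ] ℝ) (a b : Fin (m + 1) → ℝ) {f : E → ℝ} (hf : ContDiff ℝ ∞ f)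
    (hcs : HasCompactSupport f)
    (hsupp : tsupport f ⊆ e.equivFunL ⁻¹' Set.pi univ (fun j ↦ Ioo (a j) (b j)))
    (hint : ∫ y, f y ∂e.addHaar = 0) :
    ∃ η : E → E [⋀^Fin m]→L[ℝ] ℝ, ContDiff ℝ ∞ η ∧ HasCompactSupport η ∧
      tsupport η ⊆ e.equivFunL ⁻¹' Set.pi univ (fun j ↦ Ioo (a j) (b j)) ∧
      extDeriv η = fun y ↦ f y • D := by
  set A := e.equivFunL with hA
  set box : Set (Fin (m + 1) → ℝ) := Set.pi univ (fun j ↦ Ioo (a j) (b j)) with hbox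
  -- the transported function
  set F : (Fin (m + 1) → ℝ) → ℝ := fun w ↦ f (A.symm w) with hFdef
  have hFs : ContDiff ℝ ∞ F := hf.comp A.symm.contDiff
  have hFc : HasCompactSupport F := hcs.comp_homeomorph A.symm.toHomeomorph
  have hFsupp : tsupport F ⊆ box := by
    have h1 : support F ⊆ A.symm ⁻¹' tsupport f := fun w hw ↦
      subset_tsupport f (by simpa [hFdef] using hw)
    have h2 : IsClosed (A.symm ⁻¹' tsupport f) := (isClosed_tsupport f).preimage A.symm.continuous
    refine (closure_minimal h1 h2).trans fun w hw ↦ ?_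
    have := hsupp hw
    rwa [mem_preimage, ContinuousLinearEquiv.apply_symm_apply] at this
  have hFint : ∫ w, F w = 0 := by
    simp only [hFdef, hA]
    rw [integral_comp_equivFunL_symm e f]
    exact hint
  obtain ⟨X, hXs, hXc, hXsupp, hXdiv⟩ :=
    FlatPoincare.exists_sum_partialDeriv_eq_of_integral_eq_zero (m + 1) a b F hFs hFc hFsupp hFint
  -- the vector fields on `ℝ^{m+1}` and on `E`
  set V : (Fin (m + 1) → ℝ) → (Fin (m + 1) → ℝ) := fun w j ↦ X j w with hVdef
  set Y : E → E := fun z ↦ A.symm (V (A z)) with hYdef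
  have hVs : ContDiff ℝ ∞ V := contDiff_pi.2 hXs
  have hYs : ContDiff ℝ ∞ Y := A.symm.contDiff.comp (hVs.comp A.contDiff)
  have hVd : ∀ w, HasFDerivAt V (ContinuousLinearMap.pi fun j ↦ fderiv ℝ (X j) w) w := fun w ↦
    hasFDerivAt_pi.2 fun j ↦ ((hXs j).differentiable (by simp) w).hasFDerivAt
  have hYd : ∀ y, HasFDerivAt Y ((A.symm : (Fin (m + 1) → ℝ) →L[ℝ] E).comp
      ((ContinuousLinearMap.pi fun j ↦ fderiv ℝ (X j) (A y)).comp
        (A : E →L[ℝ] (Fin (m + 1) → ℝ)))) y :=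
    fun y ↦ A.symm.hasFDerivAt.comp y ((hVd (A y)).comp y A.hasFDerivAt)
  -- the divergence of `Y` is `f`
  have htrace : ∀ y, LinearMap.trace ℝ E (fderiv ℝ Y y : E →ₗ[ℝ] E) = f y := by
    intro y
    classical
    rw [(hYd y).fderiv, LinearMap.trace_eq_matrix_trace ℝ e, Matrix.trace]
    simp only [Matrix.diag, LinearMap.toMatrix_apply, ContinuousLinearMap.coe_coe,
      ContinuousLinearMap.coe_comp, comp_apply, ContinuousLinearEquiv.coe_coe,
      ContinuousLinearMap.pi_apply, hA, equivFunL_basis_apply, repr_equivFunL_symm]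
    rw [hXdiv (e.equivFunL y)]
    simp only [hFdef, hA, ContinuousLinearEquiv.symm_apply_apply]
  -- the form
  set η : E → E [⋀^Fin m]→L[ℝ] ℝ := fun z ↦ D.curryLeft (Y z) with hηdef
  have hηs : ContDiff ℝ ∞ η := D.curryLeft.contDiff.comp hYs
  -- supports
  set KX : Set (Fin (m + 1) → ℝ) := ⋃ j, tsupport (X j) with hKX
  have hKXc : IsCompact KX := isCompact_iUnion fun j ↦ (hXc j).isCompact
  have hKXbox : KX ⊆ box := iUnion_subset hXsupp
  have hY0 : ∀ z, A z ∉ KX → Y z = 0 := by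
    intro z hz
    have : V (A z) = 0 := funext fun j ↦ by
      change X j (A z) = 0
      exact image_eq_zero_of_notMem_tsupport fun h ↦ hz (mem_iUnion.2 ⟨j, h⟩)
    simp only [hYdef, this, map_zero]
  have hη0 : ∀ z, z ∉ A ⁻¹' KX → η z = 0 := by
    intro z hz
    simp only [hηdef, hY0 z hz, map_zero]
  have hKc' : IsCompact (A ⁻¹' KX) := A.toHomeomorph.isCompact_preimage.2 hKXc
  have hηsupp : tsupport η ⊆ A ⁻¹' KX :=
    closure_minimal (fun z hz ↦ by_contra fun h ↦ hz (hη0 z h)) hKc'.isClosed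
  refine ⟨η, hηs, HasCompactSupport.intro hKc' hη0, hηsupp.trans (preimage_mono hKXbox), ?_⟩
  funext y
  rw [show η = fun z ↦ D.curryLeft (Y z) from rfl,
    extDeriv_curryLeft_comp e D (hYd y).differentiableAt, htrace y]

end Transport

end Literature.NumberTheory.Transcendental
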